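import Mathlib
import Summits.Parity.GeneralizedHardyLittlewood.Theorems.FordMaynardSieveConst01651SieveConst01651HwtBound
import Summits.Parity.GeneralizedHardyLittlewood.Theorems.FordMaynardSieveConst01651SieveConst01651TypeISDR

/-!
# Route `FordMaynardSieveConst01651`, target `SieveConst01651` (stmt-Parity-19185), line `sieve_decomposition`:
# helpers towards `stub_typeIIRegion` — the BOUNDARY CASE of the smooth/rough split contributes `≪ x/(log x)^B`

The Type-II region `ℛ = Rset ν x` (composite `n` with a prime factor `≤ n^ν`) splits as
`{n : smoothPart n^ν n > 1}` (Ford–Maynard's "`n₁ > 1`", handled through (II)) and the boundary set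
`ℰ₀ = {n : every prime of n is ≥ n^ν but P⁻(n) ≤ n^ν}` = `{n : P⁻(n) = n^ν exactly}` (invisible in print, where
`P⁺(n₁) ≤ n^σ < P⁻(n₂)` silently excludes ties).  On `ℰ₀`: `n` has `≤ 1/ν` prime factors, so `τ(n) ≤ 2^{⌊1/ν⌋}` and
`|H(n)| ≤ C 2^{⌊1/ν⌋}` (`…HwtBound`); and `n ↦ P⁻(n)` is injective on `ℰ₀` (`n = P⁻(n)^{1/ν}`) with
`P⁻(n) ≤ x^ν ≤ x^{1/2}`, so (I) gives `∑_{ℰ₀} |w(n)| ≤ x/(log x)^B` (`…TypeISDR`) — no sign hypothesis on `w`.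

* `card_divisors_le_two_pow_length` — `τ(n) ≤ 2^{Ω(n)}`;
* `edgeSet_injOn_minFac` — `P⁻` is injective on `ℰ₀`;
* `edgeSet_abs_sum_le` — `∑_{n ∈ ℰ₀ ∩ (x/2, x]} |w(n) H(n)| ≤ C 2^{⌊1/ν⌋} x/(log x)^B` under (I) at level `x^{1/2}`.

Def-free. Nothing here proves anything about the Parity summit; helpers for the Type-II region stub of one leaf.
-/

open Finset Literature.NumberTheory.Sieve Literature.NumberTheory.Sieve.FordMaynard

namespace Summit.Parity.GeneralizedHardyLittlewood.FordMaynardSieveConst01651SieveConst01651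

/-- `τ(n) ≤ 2^{Ω(n)}` (divisors inject into sublists of the prime-factor list). [folklore] -/
theorem card_divisors_le_two_pow_length {n : ℕ} (hn : n ≠ 0) :
    n.divisors.card ≤ 2 ^ n.primeFactorsList.length := by
  classical
  have hmaps : Set.MapsTo (fun d : ℕ => d.primeFactorsList) ↑n.divisors
      ↑(n.primeFactorsList.sublists.toFinset) := by
    intro d hd
    simp only [Finset.mem_coe, List.mem_toFinset, List.mem_sublists] at hd ⊢
    exact Nat.primeFactorsList_sublist_of_dvd (Nat.dvd_of_mem_divisors hd) hn
  have hinj : Set.InjOn (fun d : ℕ => d.primeFactorsList) ↑n.divisors := by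
    intro a ha b hb hab
    have ha0 : a ≠ 0 := (Nat.pos_of_mem_divisors (Finset.mem_coe.1 ha)).ne'
    have hb0 : b ≠ 0 := (Nat.pos_of_mem_divisors (Finset.mem_coe.1 hb)).ne'
    simp only at hab
    calc a = a.primeFactorsList.prod := (Nat.prod_primeFactorsList ha0).symm
      _ = b.primeFactorsList.prod := by rw [hab]
      _ = b := Nat.prod_primeFactorsList hb0
  calc n.divisors.card ≤ (n.primeFactorsList.sublists.toFinset).card :=
        Finset.card_le_card_of_injOn _ hmaps hinj
    _ ≤ n.primeFactorsList.sublists.length := List.toFinset_card_le _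
    _ = 2 ^ n.primeFactorsList.length := List.length_sublists _

/-- On the boundary set (`smoothPart n^ν n = 1`, i.e. every prime `≥ n^ν`, and `P⁻(n) ≤ n^ν`) one has
`P⁻(n) = n^ν`. [folklore] -/
theorem minFac_eq_rpow_of_edge {ν : ℝ} {n : ℕ} (hn : 2 ≤ n) (hs : smoothPart ((n : ℝ) ^ ν) n = 1)
    (hmin : (n.minFac : ℝ) ≤ (n : ℝ) ^ ν) : (n.minFac : ℝ) = (n : ℝ) ^ ν := by
  refine le_antisymm hmin ?_
  have h := (le_of_smoothPart_eq_one (y := (n : ℝ) ^ ν) (by omega) hs).2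
  exact h _ (Nat.mem_primeFactors.mpr ⟨Nat.minFac_prime (by omega), Nat.minFac_dvd n, by omega⟩)

/-- **`P⁻` is injective on the boundary set** (`n = P⁻(n)^{1/ν}`). [folklore] -/
theorem edgeSet_injOn_minFac {ν : ℝ} (hν : 0 < ν) (S : Finset ℕ)
    (hS : ∀ n ∈ S, 2 ≤ n ∧ smoothPart ((n : ℝ) ^ ν) n = 1 ∧ (n.minFac : ℝ) ≤ (n : ℝ) ^ ν) :
    Set.InjOn Nat.minFac S := by
  intro a ha b hb hab
  obtain ⟨ha2, has, hamin⟩ := hS a ha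
  obtain ⟨hb2, hbs, hbmin⟩ := hS b hb
  have ha' := minFac_eq_rpow_of_edge ha2 has hamin
  have hb' := minFac_eq_rpow_of_edge hb2 hbs hbmin
  have heq : (a : ℝ) ^ ν = (b : ℝ) ^ ν := by
    rw [← ha', ← hb']; exact_mod_cast hab
  by_contra hne
  rcases lt_or_gt_of_ne hne with hlt | hgt
  · have : (a : ℝ) ^ ν < (b : ℝ) ^ ν :=
      Real.rpow_lt_rpow (Nat.cast_nonneg _) (by exact_mod_cast hlt) hν
    linarith
  · have : (b : ℝ) ^ ν < (a : ℝ) ^ ν :=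
      Real.rpow_lt_rpow (Nat.cast_nonneg _) (by exact_mod_cast hgt) hν
    linarith

/-- **The boundary case of the smooth/rough split is negligible.** Let `0 < ν ≤ 1/2`, `g` piecewise constant on
the cone. There is `C ≥ 0` such that for all `x ≥ 1`, `B ≥ 0` and every `w` satisfying (I) at level `x^{1/2}` with
exponent `B`,
`∑_{x/2 < n ≤ x, smoothPart n^ν n = 1, P⁻(n) ≤ n^ν} |w(n) H(n)| ≤ C · x/(log x)^B`.
(Uses `|H(n)| ≤ C₀ τ(n) ≤ C₀ 2^{⌊1/ν⌋}` on this set and (I) with the distinct divisor representatives `P⁻(n)`.)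
[cite: FordMaynard2024PrimeSieves, Proposition 7.19 (the ties `P⁻(n) = n^ν`, implicit in print) and §1 (I)] -/
theorem edgeSet_abs_sum_le {ν : ℝ} (hν : 0 < ν) (hν2 : ν ≤ 1 / 2) {g : VecFn} (hpc : IsPiecewiseConstOnCone g) :
    ∃ C : ℝ, 0 ≤ C ∧ ∀ x : ℝ, 1 ≤ x → ∀ B : ℝ, 0 ≤ B → ∀ w : ℕ → ℝ,
      Literature.Barriers.Parity.FordMaynard.TypeI w x (1 / 2) B →
        ∑ n ∈ ((Icc 1 ⌊x⌋₊).filter (fun n : ℕ => x / 2 < (n : ℝ))).filter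
            (fun n : ℕ => 2 ≤ n ∧ smoothPart ((n : ℝ) ^ ν) n = 1 ∧ (n.minFac : ℝ) ≤ (n : ℝ) ^ ν),
          |w n * Hwt g ν n| ≤ C * x / Real.log x ^ B := by
  obtain ⟨C₀, hC₀0, hC₀⟩ := exists_abs_Hwt_le_card_divisors hν hpc
  set K₀ : ℕ := ⌊1 / ν⌋₊ with hK₀
  refine ⟨C₀ * 2 ^ K₀, by positivity, fun x hx B hB w hI => ?_⟩
  set S := ((Icc 1 ⌊x⌋₊).filter (fun n : ℕ => x / 2 < (n : ℝ))).filter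
    (fun n : ℕ => 2 ≤ n ∧ smoothPart ((n : ℝ) ^ ν) n = 1 ∧ (n.minFac : ℝ) ≤ (n : ℝ) ^ ν) with hSdef
  have hSmem : ∀ n ∈ S, (1 ≤ n ∧ n ≤ ⌊x⌋₊) ∧ x / 2 < (n : ℝ) ∧ 2 ≤ n ∧
      smoothPart ((n : ℝ) ^ ν) n = 1 ∧ (n.minFac : ℝ) ≤ (n : ℝ) ^ ν := by
    intro n hn
    simp only [hSdef, Finset.mem_filter, Finset.mem_Icc] at hn
    exact ⟨hn.1.1, hn.1.2, hn.2⟩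
  -- `|H(n)| ≤ C₀ 2^{K₀}` on `S`
  have hH : ∀ n ∈ S, |Hwt g ν n| ≤ C₀ * 2 ^ K₀ := by
    intro n hn
    obtain ⟨_, _, hn2, hs, _⟩ := hSmem n hn
    have hn0 : n ≠ 0 := by omega
    have hrough := (le_of_smoothPart_eq_one (y := (n : ℝ) ^ ν) hn0 hs).1
    have hlen : (n.primeFactorsList.length : ℝ) * ν ≤ 1 := by
      have := length_roughPart_le_of_le ν hn2 hn0 le_rfl
      rwa [hrough] at this
    have hlenK : n.primeFactorsList.length ≤ K₀ := by
      apply Nat.le_floor; rw [le_div_iff₀ hν]; exact hlen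
    have hτ : (n.divisors.card : ℝ) ≤ 2 ^ K₀ := by
      calc (n.divisors.card : ℝ) ≤ ((2 ^ n.primeFactorsList.length : ℕ) : ℝ) := by
            exact_mod_cast card_divisors_le_two_pow_length hn0
        _ ≤ ((2 ^ K₀ : ℕ) : ℝ) := by exact_mod_cast Nat.pow_le_pow_right two_pos hlenK
        _ = 2 ^ K₀ := by push_cast; ring
    calc |Hwt g ν n| ≤ C₀ * (n.divisors.card : ℝ) := hC₀ n hn2
      _ ≤ C₀ * 2 ^ K₀ := mul_le_mul_of_nonneg_left hτ hC₀0
  -- `∑_S |w| ≤ x/(log x)^B` by (I) with representatives `P⁻(n)`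
  have hx12 : (1 : ℝ) ≤ x ^ (1 / 2 : ℝ) := Real.one_le_rpow hx (by norm_num)
  have hmass : ∑ n ∈ S, |w n| ≤ x / Real.log x ^ B := by
    refine typeI_abs_sum_le_of_injOn hI hB S Nat.minFac (fun n hn => ?_) (fun n hn => ?_)
      (edgeSet_injOn_minFac hν S fun n hn => ?_)
    · obtain ⟨⟨_, hnx⟩, hlo, _⟩ := hSmem n hn
      exact ⟨hlo, (Nat.cast_le.mpr hnx).trans (Nat.floor_le (by linarith))⟩
    · obtain ⟨⟨hn1, hnx⟩, _, hn2, _, hmin⟩ := hSmem n hn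
      refine ⟨Nat.minFac_dvd n, Nat.minFac_pos n, Nat.le_floor ?_⟩
      have hnx' : (n : ℝ) ≤ x := (Nat.cast_le.mpr hnx).trans (Nat.floor_le (by linarith))
      calc (n.minFac : ℝ) ≤ (n : ℝ) ^ ν := hmin
        _ ≤ x ^ ν := Real.rpow_le_rpow (Nat.cast_nonneg _) hnx' hν.le
        _ ≤ x ^ (1 / 2 : ℝ) := Real.rpow_le_rpow_of_exponent_le hx hν2
    · obtain ⟨_, _, hn2, hs, hmin⟩ := hSmem n hn
      exact ⟨hn2, hs, hmin⟩
  -- combine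
  calc ∑ n ∈ S, |w n * Hwt g ν n| = ∑ n ∈ S, |w n| * |Hwt g ν n| :=
        Finset.sum_congr rfl fun n _ => abs_mul _ _
    _ ≤ ∑ n ∈ S, |w n| * (C₀ * 2 ^ K₀) :=
        Finset.sum_le_sum fun n hn => mul_le_mul_of_nonneg_left (hH n hn) (abs_nonneg _)
    _ = (C₀ * 2 ^ K₀) * ∑ n ∈ S, |w n| := by rw [← Finset.sum_mul, mul_comm]
    _ ≤ (C₀ * 2 ^ K₀) * (x / Real.log x ^ B) := mul_le_mul_of_nonneg_left hmass (by positivity)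
    _ = C₀ * 2 ^ K₀ * x / Real.log x ^ B := by ring

/-! ### The case split of the Type-II region: `n₁ > 1` (main case) or the boundary set -/

/-- **`ℛ` splits as "smooth part `> 1`" ⊔ "boundary".** For `n ≥ 2`: `n` is NOT `n^ν`-rough (some prime factor is
`≤ n^ν`) iff either `smoothPart n^ν n > 1` (some prime `< n^ν`: Ford–Maynard's `n₁ > 1`, the case treated through
(II)) or `n` lies on the boundary set (`smoothPart = 1` and `P⁻(n) ≤ n^ν`, handled by `edgeSet_abs_sum_le`).
[cite: FordMaynard2024PrimeSieves, Proposition 7.19 / proof of Proposition 7.22 ("`n₁ > 1` or `k ≥ 2`")] -/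
theorem exists_prime_le_rpow_iff {ν : ℝ} {n : ℕ} (hn : 2 ≤ n) :
    (∃ p ∈ n.primeFactors, (p : ℝ) ≤ (n : ℝ) ^ ν) ↔
      (1 < smoothPart ((n : ℝ) ^ ν) n ∨
        (smoothPart ((n : ℝ) ^ ν) n = 1 ∧ (n.minFac : ℝ) ≤ (n : ℝ) ^ ν)) := by
  have hn0 : n ≠ 0 := by omega
  constructor
  · rintro ⟨p, hp, hple⟩
    rcases hple.lt_or_eq with hlt | heq
    · exact Or.inl (one_lt_smoothPart_of_lt hn0 hp hlt)
    · -- every prime is `≥ n^ν` unless some is `<`; decide by cases on the smooth part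
      by_cases hs : smoothPart ((n : ℝ) ^ ν) n = 1
      · refine Or.inr ⟨hs, ?_⟩
        have hpp := (Nat.mem_primeFactors.mp hp)
        calc (n.minFac : ℝ) ≤ (p : ℝ) := by exact_mod_cast Nat.minFac_le_of_dvd hpp.1.two_le hpp.2.1
          _ = (n : ℝ) ^ ν := heq
      · left
        have := smoothPart_ne_zero ((n : ℝ) ^ ν) hn0
        omega
  · rintro (hs | ⟨_, hmin⟩)
    · -- a prime of the smooth part is `< n^ν` and divides `n`
      have hs0 : smoothPart ((n : ℝ) ^ ν) n ≠ 0 := smoothPart_ne_zero _ hn0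
      have hs1 : smoothPart ((n : ℝ) ^ ν) n ≠ 1 := by omega
      obtain ⟨p, hp⟩ := (Nat.nonempty_primeFactors.mpr (by omega : 1 < smoothPart ((n : ℝ) ^ ν) n))
      refine ⟨p, ?_, (lt_of_mem_primeFactors_smoothPart hn0 hp).le⟩
      have hpp := Nat.mem_primeFactors.mp hp
      refine Nat.mem_primeFactors.mpr ⟨hpp.1, hpp.2.1.trans ?_, hn0⟩
      exact Nat.div_dvd_of_dvd (roughPart_ne_zero_and_dvd _ n).2
    · exact ⟨n.minFac, Nat.mem_primeFactors.mpr ⟨Nat.minFac_prime (by omega), Nat.minFac_dvd n, hn0⟩, hmin⟩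

/-- The negation of roughness in the skeleton's form `IsRough ν n := ∀ p ∈ n.primeFactors, n^ν < p`.
[cite: FordMaynard2024PrimeSieves, §7.2 (N-def)] -/
theorem not_forall_rpow_lt_iff {ν : ℝ} {n : ℕ} :
    (¬ ∀ p ∈ n.primeFactors, (n : ℝ) ^ ν < (p : ℝ)) ↔ ∃ p ∈ n.primeFactors, (p : ℝ) ≤ (n : ℝ) ^ ν := by
  push Not
  rfl

end Summit.Parity.GeneralizedHardyLittlewood.FordMaynardSieveConst01651SieveConst01651
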